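import Literature.Barriers.CriticalPhenomena.RigorousRGSmallParameterHHWReduction
import Literature.Barriers.CriticalPhenomena.RigorousRGSmallParameterHHWNewman
import Literature.Barriers.CriticalPhenomena.RigorousRGSmallParameterCriticalPoint
import HarnessLib

/-!
# `RigorousRGSmallParameterNarrow`: the narrowed barrier reduced to its printed leaves, and the
# first renormalisation-group step checked against Hara–Hattori–Watanabe §2.1

Companion to `RigorousRGSmallParameterProofs.lean`, which vendors the narrowed barrier
`Literature.Barriers.CriticalPhenomena.RigorousRGSmallParameterNarrow :=
RigorousRGSmallParameter ∧ HaraHattoriWatanabe2001_thm11` — Slade's Theorem 1.4.1 for the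
long-range `|φ|⁴` model (G. Slade, CMP 358 (2018), arXiv:1611.06169, Theorem 1.4.1, first display,
`n ≥ 1`; `RigorousRGSmallParameter = LongRangePhi4.Slade2017_thm141`) together with the published
evasion of its strong-coupling leg, Hara–Hattori–Watanabe's Theorem 1.1 (T. Hara, T. Hattori,
H. Watanabe, CMP 220 (2001) 13–40, `d = 4`: the critical trajectory `h_N = R^N h_{I,s_c}` of the
hierarchical Ising model converges weakly to the Gaussian fixed point `h_G = N(0,2)`).

## Size of a full discharge (triage: XL) and the decomposition

Both conjuncts are theories in their own right, and each is decomposed in its own companion file: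
* `RigorousRGSmallParameter` ⇐ `LongRangePhi4.Slade2017_criticalCurve` (the output of the
  Bauerschmidt–Brydges–Slade renormalisation-group flow on the critical curve: Proposition 8.2.2,
  the first display after Remark 8.2.3, Corollaries 7.2.4–7.2.5 of Slade's paper), by Theorem
  8.3.1 and the final integration step of §8.3, PROVED in
  `RigorousRGSmallParameterCriticalPoint.lean` / `RigorousRGSmallParameterSladeReduction.lean`
  (`rigorousRGSmallParameter_of_criticalCurve`);
* `HaraHattoriWatanabe2001_thm11` ⇐ `HaraHattoriWatanabe2001_eqA1` (Newman's Lee–Yang/Hadamard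
  product representation (A.1) of the moment generating function along the trajectory) ∧
  `HaraHattoriWatanabe2001_thm21` (Theorem 2.1, weak coupling, Bleher–Sinai) ∧
  `HaraHattoriWatanabe2001_thm22` (Theorem 2.2, strong coupling, computer-aided, `N₀ = 70`,
  `N₁ = 100`), by the "Proof of Theorem 1.1 for `d = 4` assuming Theorem 2.1 and Theorem 2.2"
  (p. 6) and Lévy's continuity theorem, PROVED in `RigorousRGSmallParameterHHWReduction.lean`
  (`HaraHattoriWatanabe2001_thm11_of_parts`).

## What this file does

* Records the resulting leaf set of the narrowed barrier in one place:
  `rigorousRGSmallParameterNarrow_of_parts : Slade2017_criticalCurve → eqA1 → thm21 → thm22 →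
  RigorousRGSmallParameterNarrow`, with the intermediate form from
  `Slade2017_susceptibilityDiffIneq`, the form from the two conjuncts, and the projections. After
  it, the unproved remainder of `RigorousRGSmallParameterNarrow` is exactly these four named facts
  (the renormalisation-group theory proper on the Slade side; the Lee–Yang/Hadamard/Newman
  representation, the Bleher–Sinai analysis of §3–§4 and the 100-step verified computation of §5
  on the Hara–Hattori–Watanabe side).
* Checks the transcribed renormalisation-group map against the paper ONE STEP IN (namespace
  `HierarchicalRG`). The objects of `HaraHattoriWatanabe2001_thm11` are the transcription
  `HierarchicalRG.rgMap` of (1.2) with (1.1) (`RigorousRGSmallParameterProofs.lean`; checked there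
  only at the Gaussian fixed point (1.3), `rgMap_gaussian`) and `HierarchicalRG.traj`, `mu2` …
  `mu8` of the HHW companion (checked there only at `N = 0`). §2.1 (p. 4) prints the first
  iterate in closed form: "`h_1(x) = R h_{I,s}(x) = const.(e^{βcs²/2}[δ(x - s√c) + δ(x + s√c)] +
  2δ(x))`, `ĥ_1(ξ) = (1/(1+k))(1 + k cos(√c s ξ))`, with `k = e^{βcs²/2}`,
  `μ_{2,1} = kℓ`, `μ_{4,1} = (k/6)(2k - 1)ℓ²`, `μ_{6,1} = (k/90)(16k² - 13k + 1)ℓ³`,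
  `μ_{8,1} = (k/2520)(272k³ - 297k² + 60k - 1)ℓ⁴`, etc., with `ℓ = cs²/(2(k+1))`". All six are
  PROVED here for `traj s 1 = rgMap √2 (isingLaw s)` (`c = √2`, `d = 4`):
  `integral_traj_one`, `charFun_traj_one`, `mu2_traj_one`, `mu4_traj_one`, `mu6_traj_one`,
  `mu8_traj_one` — a check of the convolution/rescaling/tilt structure of `rgMap`, of the
  normalisation `β = 1/c - 1/2` of (1.1) (through `k`), and of the moment polynomials `mu2` … `mu8`
  against data printed independently of (1.2).

Nothing new is asserted; no definition is introduced. Loci for Hara–Hattori–Watanabe are PDF pages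
of the published version (held: doi 10.1007/s002200100440).

Update (append-only): the leaf `HaraHattoriWatanabe2001_eqA1` has since been DISCHARGED
(`HaraHattoriWatanabe2001_eqA1_holds`, `RigorousRGSmallParameterHHWNewman.lean`, from the
Lee–Yang property of (2.9) proved in `RigorousRGSmallParameterHierarchicalIsing.lean` and the
tree's Hadamard factorisation); the last section records the correspondingly reduced leaf sets
`{thm21, thm22}` for `HaraHattoriWatanabe2001_thm11` and
`{Slade2017_criticalCurve, thm21, thm22}` for `RigorousRGSmallParameterNarrow`.
-/

noncomputable section

namespace Literature.Barriers.CriticalPhenomena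

open _root_.MeasureTheory _root_.ProbabilityTheory
open _root_.Complex (I)
open scoped _root_.ENNReal

/-! ### The two conjuncts -/

/-- The narrowed barrier is, by definition, the pair (Slade, Theorem 1.4.1, first display,
`n ≥ 1`; Hara–Hattori–Watanabe, Theorem 1.1, `d = 4`).
[cite: Slade2017, Theorem 1.4.1] [cite: HaraHattoriWatanabe2001, Theorem 1.1] -/
theorem rigorousRGSmallParameterNarrow_iff :
    RigorousRGSmallParameterNarrow ↔
      LongRangePhi4.Slade2017_thm141 ∧ HaraHattoriWatanabe2001_thm11 :=
  Iff.rfl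

/-- The narrowed barrier contains Hara–Hattori–Watanabe's Theorem 1.1 (the published evasion of
the strong-coupling leg; the other projection is
`RigorousRGSmallParameterNarrow.rigorousRGSmallParameter`).
[cite: HaraHattoriWatanabe2001, Theorem 1.1] -/
theorem RigorousRGSmallParameterNarrow.haraHattoriWatanabe2001_thm11
    (h : RigorousRGSmallParameterNarrow) : HaraHattoriWatanabe2001_thm11 :=
  h.2

/-- Assembly of the narrowed barrier from its two conjuncts. [cite: Slade2017, Theorem 1.4.1]
[cite: HaraHattoriWatanabe2001, Theorem 1.1] -/
theorem rigorousRGSmallParameterNarrow_of_thm141_of_thm11 (hS : LongRangePhi4.Slade2017_thm141)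
    (hH : HaraHattoriWatanabe2001_thm11) : RigorousRGSmallParameterNarrow :=
  ⟨hS, hH⟩

/-! ### The narrowed barrier from the printed leaves -/

/-- **The narrowed barrier from one printed layer down on each side**: Slade's §8.2–§8.3
conclusions in the `ν`-parametrisation (`LongRangePhi4.Slade2017_susceptibilityDiffIneq`,
integrated to Theorem 1.4.1 by "Proof of Theorem 1.4.1", §8.3) and the three named parts of the
Hara–Hattori–Watanabe proof ((A.1), Theorem 2.1, Theorem 2.2, assembled by §2.3 and Lévy's
theorem). [cite: Slade2017, §8.3, Proof of Theorem 1.4.1]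
[cite: HaraHattoriWatanabe2001, §2.3 (p. 6)] -/
theorem rigorousRGSmallParameterNarrow_of_susceptibilityDiffIneq_of_parts
    (hS : LongRangePhi4.Slade2017_susceptibilityDiffIneq) (hA : HaraHattoriWatanabe2001_eqA1)
    (h21 : HaraHattoriWatanabe2001_thm21) (h22 : HaraHattoriWatanabe2001_thm22) :
    RigorousRGSmallParameterNarrow :=
  ⟨rigorousRGSmallParameter_of_susceptibilityDiffIneq hS,
    HaraHattoriWatanabe2001_thm11_of_parts hA h21 h22⟩

/-- **The narrowed barrier from its leaves.** `RigorousRGSmallParameterNarrow` follows from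
(i) the renormalisation-group output on Slade's critical curve
(`LongRangePhi4.Slade2017_criticalCurve`: Proposition 8.2.2, the first display after Remark 8.2.3,
Corollaries 7.2.4–7.2.5), via Theorem 8.3.1 and §8.3, and (ii) Newman's representation (A.1) along
the hierarchical trajectory, HHW Theorem 2.1 and HHW Theorem 2.2, via §2.3 (p. 6) — every step
above the leaves being proved in the companion files. The trust base of the narrowed barrier is
thereby exactly `{Slade2017_criticalCurve, HaraHattoriWatanabe2001_eqA1,
HaraHattoriWatanabe2001_thm21, HaraHattoriWatanabe2001_thm22}`.
[cite: Slade2017, §8.3 (Theorem 8.3.1 and Proof of Theorem 1.4.1)]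
[cite: HaraHattoriWatanabe2001, §2.3 (p. 6, Proof of Theorem 1.1 for d = 4)] -/
theorem rigorousRGSmallParameterNarrow_of_parts (hS : LongRangePhi4.Slade2017_criticalCurve)
    (hA : HaraHattoriWatanabe2001_eqA1) (h21 : HaraHattoriWatanabe2001_thm21)
    (h22 : HaraHattoriWatanabe2001_thm22) : RigorousRGSmallParameterNarrow :=
  ⟨rigorousRGSmallParameter_of_criticalCurve hS, HaraHattoriWatanabe2001_thm11_of_parts hA h21 h22⟩

/-! ### The first renormalisation-group step `h_1 = R h_{I,s}` against §2.1 (p. 4) -/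

namespace HierarchicalRG

open IsingStrongCouplingLimit

/-- The law of the sum of two independent Ising spins `±s`:
`h_{I,s} ∗ h_{I,s} = ¼(δ_{2s} + δ_0 + δ_0 + δ_{-2s})` (written with `s + s`, `s + -s`, …, as
Mathlib's `dirac_conv_dirac` produces it). [folklore] -/
theorem isingLaw_conv_isingLaw (s : ℝ) :
    isingLaw s ∗ isingLaw s =
      (4 : ℝ≥0∞)⁻¹ • ((Measure.dirac (s + s) + Measure.dirac (s + -s)) +
        (Measure.dirac (-s + s) + Measure.dirac (-s + -s))) := by
  unfold isingLaw
  rw [Measure.conv_smul_left, Measure.conv_smul_right, Measure.add_conv, Measure.conv_add,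
    Measure.conv_add]
  simp only [Measure.dirac_conv_dirac]
  rw [smul_smul]
  congr 1
  rw [← ENNReal.mul_inv (Or.inl (by norm_num)) (Or.inl (by norm_num))]
  norm_num

variable {E : Type*} [NormedAddCommGroup E] [NormedSpace ℝ E] [CompleteSpace E]

/-- Expectations under the rescaled block spin `a(X + X')` of two independent Ising spins (the
measure inside the tilt of `rgMap`, before normalisation): the uniform average over the four
configurations. [folklore] -/
theorem integral_pairLaw (s a : ℝ) (ha : a ≠ 0) (φ : ℝ → E) :
    ∫ x, φ x ∂((isingLaw s ∗ isingLaw s).map (fun x => a * x)) =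
      (4 : ℝ)⁻¹ •
        (φ (a * (s + s)) + φ (a * (s + -s)) + (φ (a * (-s + s)) + φ (a * (-s + -s)))) := by
  rw [(measurableEmbedding_mulLeft₀ ha).integral_map, isingLaw_conv_isingLaw,
    integral_smul_measure]
  have hi : ∀ b : ℝ, Integrable (fun x => φ (a * x)) (Measure.dirac b) := fun b =>
    integrable_dirac (by simp)
  rw [integral_add_measure ((hi _).add_measure (hi _)) ((hi _).add_measure (hi _)),
    integral_add_measure (hi _) (hi _), integral_add_measure (hi _) (hi _)]
  simp only [integral_dirac]
  rw [ENNReal.toReal_inv]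
  norm_num

/-- `(√c)² = c` at `c = √2` (the block-spin factor of (1.2) is `√c/2`; `d = 4 ⇔ c = √2`, (1.4)).
[cite: HaraHattoriWatanabe2001, §1 eq. (1.4)] -/
theorem sqrt_sqrt_two_sq : Real.sqrt (Real.sqrt 2) ^ 2 = Real.sqrt 2 :=
  Real.sq_sqrt (Real.sqrt_nonneg 2)

/-- **HHW §2.1, the first iterate (p. 4), PROVED for the transcription:**
"`h_1(x) = R h_{I,s}(x) = const.(e^{βcs²/2}[δ(x - s√c) + δ(x + s√c)] + 2δ(x))`", `c = √2`, as
the statement that expectations under `traj s 1 = rgMap √2 (isingLaw s)` are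
`(k(g(s√c) + g(-s√c)) + 2g(0))/(2k + 2)` with `k = e^{βcs²/2}`, `β = 1/c - 1/2` ((1.1)).
[cite: HaraHattoriWatanabe2001, §2.1 (p. 4, formula for h_1 = R h_{I,s})] -/
theorem integral_traj_one (s : ℝ) (g : ℝ → ℝ) :
    ∫ x, g x ∂(traj s 1) =
      (Real.exp (beta (Real.sqrt 2) * Real.sqrt 2 * s ^ 2 / 2) *
          (g (Real.sqrt (Real.sqrt 2) * s) + g (-(Real.sqrt (Real.sqrt 2) * s))) + 2 * g 0) /
        (2 * Real.exp (beta (Real.sqrt 2) * Real.sqrt 2 * s ^ 2 / 2) + 2) := by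
  rw [traj_succ, traj_zero]
  unfold rgMap
  have ha : Real.sqrt (Real.sqrt 2) / 2 ≠ 0 := by positivity
  rw [integral_tilted, integral_pairLaw s _ ha, integral_pairLaw s _ ha]
  simp only [smul_eq_mul]
  have e1 : Real.sqrt (Real.sqrt 2) / 2 * (s + s) = Real.sqrt (Real.sqrt 2) * s := by ring
  have e2 : Real.sqrt (Real.sqrt 2) / 2 * (s + -s) = 0 := by ring
  have e3 : Real.sqrt (Real.sqrt 2) / 2 * (-s + s) = 0 := by ring
  have e4 : Real.sqrt (Real.sqrt 2) / 2 * (-s + -s) = -(Real.sqrt (Real.sqrt 2) * s) := by ring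
  have e5 : beta (Real.sqrt 2) / 2 * (Real.sqrt (Real.sqrt 2) * s) ^ 2 =
      beta (Real.sqrt 2) * Real.sqrt 2 * s ^ 2 / 2 := by
    rw [mul_pow, sqrt_sqrt_two_sq]; ring
  have e6 : beta (Real.sqrt 2) / 2 * (-(Real.sqrt (Real.sqrt 2) * s)) ^ 2 =
      beta (Real.sqrt 2) * Real.sqrt 2 * s ^ 2 / 2 := by
    rw [neg_sq, mul_pow, sqrt_sqrt_two_sq]; ring
  simp only [e1, e2, e3, e4, e5, e6]
  simp only [ne_eq, OfNat.ofNat_ne_zero, not_false_eq_true, zero_pow, mul_zero, Real.exp_zero]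
  set k := Real.exp (beta (Real.sqrt 2) * Real.sqrt 2 * s ^ 2 / 2) with hk
  have hkpos : 0 < k := Real.exp_pos _
  have hZ : (k + 1 + (1 + k)) / 4 ≠ 0 := by positivity
  field_simp
  ring

/-- **HHW §2.1 (p. 4), PROVED for the transcription:** "`ĥ_1(ξ) = (1/(1+k))(1 + k cos(√c s ξ))`,
with `k = e^{βcs²/2}`" — the characteristic function (Mathlib `charFun`, (2.1)) of
`traj s 1 = R h_{I,s}` at `c = √2`.
[cite: HaraHattoriWatanabe2001, §2.1 (p. 4, formula for ĥ_1)] -/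
theorem charFun_traj_one (s ξ : ℝ) :
    charFun (traj s 1) ξ =
      (((1 + Real.exp (beta (Real.sqrt 2) * Real.sqrt 2 * s ^ 2 / 2) *
          Real.cos (Real.sqrt (Real.sqrt 2) * s * ξ)) /
        (1 + Real.exp (beta (Real.sqrt 2) * Real.sqrt 2 * s ^ 2 / 2)) : ℝ) : ℂ) := by
  rw [charFun_apply_real, traj_succ, traj_zero]
  unfold rgMap
  have ha : Real.sqrt (Real.sqrt 2) / 2 ≠ 0 := by positivity
  rw [integral_tilted, integral_pairLaw s _ ha, integral_pairLaw s _ ha]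
  simp only [smul_eq_mul, Complex.real_smul]
  have e1 : Real.sqrt (Real.sqrt 2) / 2 * (s + s) = Real.sqrt (Real.sqrt 2) * s := by ring
  have e2 : Real.sqrt (Real.sqrt 2) / 2 * (s + -s) = 0 := by ring
  have e3 : Real.sqrt (Real.sqrt 2) / 2 * (-s + s) = 0 := by ring
  have e4 : Real.sqrt (Real.sqrt 2) / 2 * (-s + -s) = -(Real.sqrt (Real.sqrt 2) * s) := by ring
  have e5 : beta (Real.sqrt 2) / 2 * (Real.sqrt (Real.sqrt 2) * s) ^ 2 =
      beta (Real.sqrt 2) * Real.sqrt 2 * s ^ 2 / 2 := by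
    rw [mul_pow, sqrt_sqrt_two_sq]; ring
  have e6 : beta (Real.sqrt 2) / 2 * (-(Real.sqrt (Real.sqrt 2) * s)) ^ 2 =
      beta (Real.sqrt 2) * Real.sqrt 2 * s ^ 2 / 2 := by
    rw [neg_sq, mul_pow, sqrt_sqrt_two_sq]; ring
  simp only [e1, e2, e3, e4, e5, e6]
  simp only [ne_eq, OfNat.ofNat_ne_zero, not_false_eq_true, zero_pow, mul_zero, Real.exp_zero,
    Complex.ofReal_zero, zero_mul, Complex.exp_zero, mul_one]
  set k := Real.exp (beta (Real.sqrt 2) * Real.sqrt 2 * s ^ 2 / 2) with hk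
  set y := Real.sqrt (Real.sqrt 2) * s with hy
  have hkpos : 0 < k := Real.exp_pos _
  have hneg : Complex.exp (↑ξ * ↑(-y) * I) =
      2 * (Real.cos (y * ξ) : ℂ) - Complex.exp (↑ξ * ↑y * I) := by
    rw [Complex.ofReal_cos, Complex.cos]
    push_cast
    ring_nf
  rw [hneg]
  have hZeq : (4⁻¹ * (k + 1 + (1 + k)) : ℝ) = (k + 1) / 2 := by ring
  rw [hZeq]
  push_cast
  have h1 : (k : ℂ) + 1 ≠ 0 := by exact_mod_cast (show (k + 1 : ℝ) ≠ 0 by positivity)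
  have h2 : (1 : ℂ) + k ≠ 0 := by exact_mod_cast (show (1 + k : ℝ) ≠ 0 by positivity)
  field_simp
  ring

/-- The even moments of the first iterate: `∫ x^{2n} dh_1 = k(2(k+1)ℓ)ⁿ/(k+1)` for `n ≥ 1`, in
HHW's abbreviations `k = e^{βcs²/2}`, `ℓ = cs²/(2(k+1))` (so that `(s√c)² = cs² = 2(k+1)ℓ`),
`c = √2`. [cite: HaraHattoriWatanabe2001, §2.1 (p. 4)] -/
theorem integral_pow_two_mul_traj_one (s : ℝ) {k ℓ : ℝ}
    (hk : k = Real.exp (beta (Real.sqrt 2) * Real.sqrt 2 * s ^ 2 / 2))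
    (hℓ : ℓ = Real.sqrt 2 * s ^ 2 / (2 * (k + 1))) {n : ℕ} (hn : n ≠ 0) :
    ∫ x, x ^ (2 * n) ∂(traj s 1) = k * (2 * (k + 1) * ℓ) ^ n / (k + 1) := by
  have hkpos : 0 < k := by rw [hk]; exact Real.exp_pos _
  have hs2 : Real.sqrt 2 * s ^ 2 = 2 * (k + 1) * ℓ := by
    rw [hℓ]; field_simp
  have epow : (Real.sqrt (Real.sqrt 2) * s) ^ (2 * n) = (2 * (k + 1) * ℓ) ^ n := by
    rw [pow_mul, mul_pow, sqrt_sqrt_two_sq, ← hs2]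
  rw [integral_traj_one, (even_two_mul n).neg_pow, epow, zero_pow (by omega), ← hk]
  field_simp
  ring

/-- **HHW §2.1 (p. 4), PROVED for the transcription: `μ_{2,1} = kℓ`** (`k = e^{βcs²/2}`,
`ℓ = cs²/(2(k+1))`, `c = √2`). [cite: HaraHattoriWatanabe2001, §2.1 (p. 4, formula for μ_{2,1})] -/
theorem mu2_traj_one (s : ℝ) {k ℓ : ℝ}
    (hk : k = Real.exp (beta (Real.sqrt 2) * Real.sqrt 2 * s ^ 2 / 2))
    (hℓ : ℓ = Real.sqrt 2 * s ^ 2 / (2 * (k + 1))) :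
    mu2 (traj s 1) = k * ℓ := by
  have hkpos : 0 < k := by rw [hk]; exact Real.exp_pos _
  rw [mu2, taylorA, moment_id_eq, integral_pow_two_mul_traj_one s hk hℓ one_ne_zero]
  norm_num [Nat.factorial]
  field_simp

/-- **HHW §2.1 (p. 4), PROVED for the transcription: `μ_{4,1} = (k/6)(2k - 1)ℓ²`.**
[cite: HaraHattoriWatanabe2001, §2.1 (p. 4, formula for μ_{4,1})] -/
theorem mu4_traj_one (s : ℝ) {k ℓ : ℝ}
    (hk : k = Real.exp (beta (Real.sqrt 2) * Real.sqrt 2 * s ^ 2 / 2))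
    (hℓ : ℓ = Real.sqrt 2 * s ^ 2 / (2 * (k + 1))) :
    mu4 (traj s 1) = k / 6 * (2 * k - 1) * ℓ ^ 2 := by
  have hkpos : 0 < k := by rw [hk]; exact Real.exp_pos _
  rw [mu4, taylorA, taylorA, moment_id_eq, moment_id_eq,
    integral_pow_two_mul_traj_one s hk hℓ one_ne_zero,
    integral_pow_two_mul_traj_one s hk hℓ two_ne_zero]
  norm_num [Nat.factorial]
  field_simp
  ring

/-- **HHW §2.1 (p. 4), PROVED for the transcription: `μ_{6,1} = (k/90)(16k² - 13k + 1)ℓ³`.**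
[cite: HaraHattoriWatanabe2001, §2.1 (p. 4, formula for μ_{6,1})] -/
theorem mu6_traj_one (s : ℝ) {k ℓ : ℝ}
    (hk : k = Real.exp (beta (Real.sqrt 2) * Real.sqrt 2 * s ^ 2 / 2))
    (hℓ : ℓ = Real.sqrt 2 * s ^ 2 / (2 * (k + 1))) :
    mu6 (traj s 1) = k / 90 * (16 * k ^ 2 - 13 * k + 1) * ℓ ^ 3 := by
  have hkpos : 0 < k := by rw [hk]; exact Real.exp_pos _
  rw [mu6, taylorA, taylorA, taylorA, moment_id_eq, moment_id_eq, moment_id_eq,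
    integral_pow_two_mul_traj_one s hk hℓ one_ne_zero,
    integral_pow_two_mul_traj_one s hk hℓ two_ne_zero,
    integral_pow_two_mul_traj_one s hk hℓ three_ne_zero]
  norm_num [Nat.factorial]
  field_simp
  ring

/-- **HHW §2.1 (p. 4), PROVED for the transcription:
`μ_{8,1} = (k/2520)(272k³ - 297k² + 60k - 1)ℓ⁴`.**
[cite: HaraHattoriWatanabe2001, §2.1 (p. 4, formula for μ_{8,1})] -/
theorem mu8_traj_one (s : ℝ) {k ℓ : ℝ}
    (hk : k = Real.exp (beta (Real.sqrt 2) * Real.sqrt 2 * s ^ 2 / 2))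
    (hℓ : ℓ = Real.sqrt 2 * s ^ 2 / (2 * (k + 1))) :
    mu8 (traj s 1) = k / 2520 * (272 * k ^ 3 - 297 * k ^ 2 + 60 * k - 1) * ℓ ^ 4 := by
  have hkpos : 0 < k := by rw [hk]; exact Real.exp_pos _
  rw [mu8, taylorA, taylorA, taylorA, taylorA, moment_id_eq, moment_id_eq, moment_id_eq,
    moment_id_eq,
    integral_pow_two_mul_traj_one s hk hℓ one_ne_zero,
    integral_pow_two_mul_traj_one s hk hℓ two_ne_zero,
    integral_pow_two_mul_traj_one s hk hℓ three_ne_zero,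
    integral_pow_two_mul_traj_one s hk hℓ four_ne_zero]
  norm_num [Nat.factorial]
  field_simp
  ring

end HierarchicalRG

/-! ### After the discharge of (A.1): the reduced leaf sets -/

/-- **HHW Theorem 1.1 from Theorems 2.1 and 2.2 alone**: with (A.1) proved
(`HaraHattoriWatanabe2001_eqA1_holds`), the trust base of `HaraHattoriWatanabe2001_thm11` is
`{HaraHattoriWatanabe2001_thm21, HaraHattoriWatanabe2001_thm22}` — exactly the paper's "Proof of
Theorem 1.1 for `d = 4` assuming Theorem 2.1 and Theorem 2.2".
[cite: HaraHattoriWatanabe2001, §2.3 (p. 6, Proof of Theorem 1.1 for d = 4)] -/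
theorem HaraHattoriWatanabe2001_thm11_of_thm21_of_thm22 (h21 : HaraHattoriWatanabe2001_thm21)
    (h22 : HaraHattoriWatanabe2001_thm22) : HaraHattoriWatanabe2001_thm11 :=
  HaraHattoriWatanabe2001_thm11_of_parts HaraHattoriWatanabe2001_eqA1_holds h21 h22

/-- **The narrowed barrier from three leaves**: the renormalisation-group output on Slade's
critical curve, HHW Theorem 2.1 (Bleher–Sinai) and HHW Theorem 2.2 (computer-aided) — everything
else (Slade §8.3; HHW (2.9), its Lee–Yang property, (A.1), §2.3 and Lévy's theorem) being proved.
[cite: Slade2017, §8.3 (Theorem 8.3.1 and Proof of Theorem 1.4.1)]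
[cite: HaraHattoriWatanabe2001, §2.3 (p. 6) and Appendix A eq. (A.1)] -/
theorem rigorousRGSmallParameterNarrow_of_criticalCurve_of_thm21_of_thm22
    (hS : LongRangePhi4.Slade2017_criticalCurve) (h21 : HaraHattoriWatanabe2001_thm21)
    (h22 : HaraHattoriWatanabe2001_thm22) : RigorousRGSmallParameterNarrow :=
  rigorousRGSmallParameterNarrow_of_parts hS HaraHattoriWatanabe2001_eqA1_holds h21 h22

end Literature.Barriers.CriticalPhenomena

end
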